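import Mathlib
import Summits.ValiantsHypothesis.ValiantsHypothesis.Theorems.FifoMatchingNNNotVPTokenGame
import HarnessLib

/-!
# Route FifoMatching — crux `NNNotVP` (stmt-ValiantsHypothesis-11615), line `division_split`:
# round structures EXIST on `Fin (2n)`, `n = k + R N` (instance of the token-game framework)

Companion of `…TokenGame` / `…TokenGameMatching` (framework for the clique gadget of stub A
`stub_supportFnHard`; design record in the docstring of `…TokenGame`).  The framework is stated
over an abstract linear order covered by layers `first` / `act j` / `tok j` / `last`; this file
provides, for all `k R N`, such a layer decomposition of `Fin (2 (k + R N))` together with a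
DECODER `dec` (inverse of the layer maps), so that a token program's projection
`e : σ n → E(K_m) ⊕ Bool` can be defined by pattern matching on `(dec a, dec b)`:

* `exists_roundStructure` — `∃ first act tok last lay dec` with: `lay` monotone with the layer
  values `0 / 2j+1 / 2j+2 / 2R+1`, every layer map increasing, `dec` a two-sided inverse of the
  combined layer map (hence the coverage hypothesis of the framework).

Construction: the lexicographic sum `Fin k ⊕ₗ ((Fin (2R) ×ₗ Fin N) ⊕ₗ Fin k)` (middle index
`(2j, q)` = `act j q`, `(2j+1, q)` = `tok j q`) has `2 (k + R N)` elements; transport along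
`Fintype.orderIsoFinOfCardEq`.

Honest framing: bookkeeping; the gadget is NOT constructed here, stubs Z / A / B2, the crux
`NNNotVP` and `VP ≠ VNP` stay OPEN (NOT proved).  No definitions, no named facts.
-/

noncomputable section

-- Sub = Summit single-conjunct layout: the duplicated namespace component is mandated by the tree.
set_option linter.dupNamespace false

namespace Summit.ValiantsHypothesis.ValiantsHypothesis.Theorems.FifoMatching.NNNotVP.DivisionSplit

open Finset

/-- **Round structures exist on `Fin (2 (k + R N))`.**  Layer maps `first` (layer `0`), `act j`
(layer `2j+1`), `tok j` (layer `2j+2`), `last` (layer `2R+1`), a monotone layer function `lay`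
and a decoder `dec` inverse to the layer maps. [folklore] -/
theorem exists_roundStructure (k R N : ℕ) :
    ∃ (first : Fin k → Fin (2 * (k + R * N))) (act tok : Fin R → Fin N → Fin (2 * (k + R * N)))
      (last : Fin k → Fin (2 * (k + R * N))) (lay : Fin (2 * (k + R * N)) → ℕ)
      (dec : Fin (2 * (k + R * N)) → Fin k ⊕ ((Fin R × Fin N) ⊕ ((Fin R × Fin N) ⊕ Fin k))),
      Monotone lay ∧ (∀ i, lay (first i) = 0) ∧ (∀ j q, lay (act j q) = 2 * j + 1) ∧
      (∀ j q, lay (tok j q) = 2 * j + 2) ∧ (∀ i, lay (last i) = 2 * R + 1) ∧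
      StrictMono first ∧ (∀ j, StrictMono (act j)) ∧ (∀ j, StrictMono (tok j)) ∧
      StrictMono last ∧
      (∀ i, dec (first i) = Sum.inl i) ∧ (∀ j q, dec (act j q) = Sum.inr (Sum.inl (j, q))) ∧
      (∀ j q, dec (tok j q) = Sum.inr (Sum.inr (Sum.inl (j, q)))) ∧
      (∀ i, dec (last i) = Sum.inr (Sum.inr (Sum.inr i))) ∧
      ∀ a, a = Sum.elim first (Sum.elim (fun jq => act jq.1 jq.2)
        (Sum.elim (fun jq => tok jq.1 jq.2) last)) (dec a) := by
  classical
  -- the lexicographic model and its decoding to the plain sum type `D`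
  have hcard : Fintype.card (Fin k ⊕ₗ ((Fin (2 * R) ×ₗ Fin N) ⊕ₗ Fin k)) = 2 * (k + R * N) := by
    simp only [Fintype.card_lex, Fintype.card_sum, Fintype.card_prod, Fintype.card_fin]
    ring
  let E : Fin (2 * (k + R * N)) ≃o (Fin k ⊕ₗ ((Fin (2 * R) ×ₗ Fin N) ⊕ₗ Fin k)) :=
    Fintype.orderIsoFinOfCardEq _ hcard
  let emb : Fin k ⊕ ((Fin R × Fin N) ⊕ ((Fin R × Fin N) ⊕ Fin k)) →
      (Fin k ⊕ₗ ((Fin (2 * R) ×ₗ Fin N) ⊕ₗ Fin k)) := fun d =>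
    match d with
    | Sum.inl i => toLex (Sum.inl i)
    | Sum.inr (Sum.inl jq) =>
        toLex (Sum.inr (toLex (Sum.inl (toLex ((⟨2 * jq.1.val, by omega⟩ : Fin (2 * R)), jq.2)))))
    | Sum.inr (Sum.inr (Sum.inl jq)) =>
        toLex (Sum.inr (toLex (Sum.inl
          (toLex ((⟨2 * jq.1.val + 1, by omega⟩ : Fin (2 * R)), jq.2)))))
    | Sum.inr (Sum.inr (Sum.inr i)) => toLex (Sum.inr (toLex (Sum.inr i)))
  let decC : (Fin k ⊕ₗ ((Fin (2 * R) ×ₗ Fin N) ⊕ₗ Fin k)) →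
      Fin k ⊕ ((Fin R × Fin N) ⊕ ((Fin R × Fin N) ⊕ Fin k)) := fun c =>
    match ofLex c with
    | Sum.inl i => Sum.inl i
    | Sum.inr z =>
      match ofLex z with
      | Sum.inl tq =>
        if (ofLex tq).1.val % 2 = 0 then
          Sum.inr (Sum.inl (⟨(ofLex tq).1.val / 2, by have := (ofLex tq).1.isLt; omega⟩,
            (ofLex tq).2))
        else Sum.inr (Sum.inr (Sum.inl
          (⟨(ofLex tq).1.val / 2, by have := (ofLex tq).1.isLt; omega⟩, (ofLex tq).2)))
      | Sum.inr i => Sum.inr (Sum.inr (Sum.inr i))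
  -- layer of a plain element
  let layD : Fin k ⊕ ((Fin R × Fin N) ⊕ ((Fin R × Fin N) ⊕ Fin k)) → ℕ := fun d =>
    match d with
    | Sum.inl _ => 0
    | Sum.inr (Sum.inl jq) => 2 * jq.1.val + 1
    | Sum.inr (Sum.inr (Sum.inl jq)) => 2 * jq.1.val + 2
    | Sum.inr (Sum.inr (Sum.inr _)) => 2 * R + 1
  -- `decC ∘ emb = id`
  have hde : ∀ d, decC (emb d) = d := by
    intro d
    rcases d with i | ⟨j, q⟩ | ⟨j, q⟩ | i
    · rfl
    · simp only [emb, decC, ofLex_toLex]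
      rw [if_pos (by omega)]
      congr
      omega
    · simp only [emb, decC, ofLex_toLex]
      rw [if_neg (by omega)]
      congr
      omega
    · rfl
  -- hence `emb` is a bijection and `emb ∘ decC = id`
  have hemb_inj : Function.Injective emb := fun d d' h => by
    rw [← hde d, ← hde d', h]
  have hcardD : Fintype.card (Fin k ⊕ ((Fin R × Fin N) ⊕ ((Fin R × Fin N) ⊕ Fin k))) =
      Fintype.card (Fin k ⊕ₗ ((Fin (2 * R) ×ₗ Fin N) ⊕ₗ Fin k)) := by
    rw [hcard]
    simp only [Fintype.card_sum, Fintype.card_prod, Fintype.card_fin]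
    ring
  have hemb_bij : Function.Bijective emb :=
    (Fintype.bijective_iff_injective_and_card emb).2 ⟨hemb_inj, hcardD⟩
  have hed : ∀ c, emb (decC c) = c := by
    intro c
    obtain ⟨d, rfl⟩ := hemb_bij.2 c
    rw [hde]
  -- order comparison of embedded elements: by layer, then by index
  have hlayD_mono : ∀ d d', emb d ≤ emb d' → layD d ≤ layD d' := by
    intro d d' h
    rcases d with i | ⟨j, q⟩ | ⟨j, q⟩ | i <;> rcases d' with i' | ⟨j', q'⟩ | ⟨j', q'⟩ | i' <;>
      simp only [emb, layD, Sum.Lex.inl_le_inl_iff, Sum.Lex.inr_le_inr_iff, Sum.Lex.inl_le_inr,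
        Sum.Lex.not_inr_le_inl, Prod.Lex.toLex_le_toLex, Fin.mk_lt_mk, Fin.mk.injEq] at h ⊢ <;>
      omega
  -- the structure
  refine ⟨fun i => E.symm (emb (Sum.inl i)), fun j q => E.symm (emb (Sum.inr (Sum.inl (j, q)))),
    fun j q => E.symm (emb (Sum.inr (Sum.inr (Sum.inl (j, q))))),
    fun i => E.symm (emb (Sum.inr (Sum.inr (Sum.inr i)))), fun a => layD (decC (E a)),
    fun a => decC (E a), ?_, ?_, ?_, ?_, ?_, ?_, ?_, ?_, ?_, ?_, ?_, ?_, ?_, ?_⟩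
  · -- monotone
    intro a b hab
    have h : E a ≤ E b := E.monotone hab
    rw [← hed (E a), ← hed (E b)] at h
    have := hlayD_mono _ _ h
    exact this
  · intro i; simp only [OrderIso.apply_symm_apply, hde]; rfl
  · intro j q; simp only [OrderIso.apply_symm_apply, hde]; rfl
  · intro j q; simp only [OrderIso.apply_symm_apply, hde]; rfl
  · intro i; simp only [OrderIso.apply_symm_apply, hde]; rfl
  · intro i i' h
    apply E.symm.strictMono
    simp only [emb]
    exact Sum.Lex.inl_lt_inl_iff.2 h
  · intro j q q' h
    apply E.symm.strictMono
    simp only [emb]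
    exact Sum.Lex.inr_lt_inr_iff.2 (Sum.Lex.inl_lt_inl_iff.2 (Prod.Lex.toLex_lt_toLex.2
      (Or.inr ⟨rfl, h⟩)))
  · intro j q q' h
    apply E.symm.strictMono
    simp only [emb]
    exact Sum.Lex.inr_lt_inr_iff.2 (Sum.Lex.inl_lt_inl_iff.2 (Prod.Lex.toLex_lt_toLex.2
      (Or.inr ⟨rfl, h⟩)))
  · intro i i' h
    apply E.symm.strictMono
    simp only [emb]
    exact Sum.Lex.inr_lt_inr_iff.2 (Sum.Lex.inr_lt_inr_iff.2 h)
  · intro i; simp only [OrderIso.apply_symm_apply, hde]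
  · intro j q; simp only [OrderIso.apply_symm_apply, hde]
  · intro j q; simp only [OrderIso.apply_symm_apply, hde]
  · intro i; simp only [OrderIso.apply_symm_apply, hde]
  · intro a
    have key : ∀ d, Sum.elim (fun i => E.symm (emb (Sum.inl i)))
        (Sum.elim (fun jq : Fin R × Fin N => E.symm (emb (Sum.inr (Sum.inl (jq.1, jq.2)))))
          (Sum.elim (fun jq : Fin R × Fin N => E.symm (emb (Sum.inr (Sum.inr (Sum.inl (jq.1, jq.2))))))
            (fun i => E.symm (emb (Sum.inr (Sum.inr (Sum.inr i))))))) d = E.symm (emb d) := by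
      intro d
      rcases d with i | ⟨j, q⟩ | ⟨j, q⟩ | i <;> rfl
    rw [key, hed, OrderIso.symm_apply_apply]

end Summit.ValiantsHypothesis.ValiantsHypothesis.Theorems.FifoMatching.NNNotVP.DivisionSplit

end
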